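import Summits.HubbardSuperconductivity.HubbardSuperconductivity.Theses.DeformationLadder
import Summits.HubbardSuperconductivity.HubbardSuperconductivity.Theses.TwistGap
import Summits.HubbardSuperconductivity.HubbardSuperconductivity.Theorems.DeformationLadderAssembly
import Summits.HubbardSuperconductivity.HubbardSuperconductivity.Theorems.DeformationLadderLadderThesisSplit
import Summits.HubbardSuperconductivity.HubbardSuperconductivity.Theorems.DeformationLadderLadderThesisNormalForms
import Summits.HubbardSuperconductivity.HubbardSuperconductivity.Theorems.TwistGapTgCondensationOfRigidity
import HarnessLib
import HarnessLib.Audit.CruxProbe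

/-!
# Strategist r1 — mechanical C→S / S→C probes for crux `LadderThesis` (stmt-1890) and the D1 children

BC2/BC7-style probes (`#h21_crux_probe`), run against the REAL route modules with the landed
Theorems imported, so that P5 (`C → S` by `exact?`) can see `deformationLadder_assembly_proof`.
Expected: `LadderThesis` fires `crux.implies-summit` (summit strength, certified by name below);
the two TwistGap children are CLEAN on P5 in both directions.
-/

namespace Summit.HubbardSuperconductivity.HubbardSuperconductivity.Cruxes.LadderThesis.StrategistR1

open Summit.HubbardSuperconductivity.HubbardSuperconductivity.Theses.DeformationLadder
open Summit.HubbardSuperconductivity.HubbardSuperconductivity.Theses.TwistGap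
open Summit.HubbardSuperconductivity.HubbardSuperconductivity.Theorems
open Summit.HubbardSuperconductivity.HubbardSuperconductivity.Theorems.DeformationLadder

/-! ## §A The theorem that makes the crux summit-strength (T1: C ⇒ S certified, by name) -/

/-- `LadderThesis → HubbardSuperconductivity` — the route's landed Assembly (Kaplan–Horsch–von der
Linden two-line comparison + even-side liminf bookkeeping), `deformationLadder_assembly_proof`. -/
theorem ladderThesis_implies_summit (hX : LadderThesis) : _root_.HubbardSuperconductivity :=
  deformationLadder_assembly_proof hX

/-- The same through the route's own `closes` (its other two binders are landed items). -/
theorem ladderThesis_implies_summit' (hX : LadderThesis) : _root_.HubbardSuperconductivity :=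
  Summit.HubbardSuperconductivity.HubbardSuperconductivity.Theses.DeformationLadder.closes hX
    rigidityGlue_proof deformationLadder_assembly_proof

/-- The equivalence class of the corner, by name (p89166): crux ≡ LowEnergyRigidity ≡ TgThesis. -/
theorem corner_class : (LadderThesis ↔ LowEnergyRigidity) ∧ (LadderThesis ↔ TgThesis) :=
  ⟨ladderThesis_iff_lowEnergyRigidity, ladderThesis_iff_tgThesis⟩

/-- D1 assembly (landed): the two TwistGap cruxes give the crux by name. -/
theorem d1_assembly (hR : TgPairMomentumRigidity) (hC : TgLowEnergyCondensation) : LadderThesis :=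
  ladderThesis_of_tgCruxes hR hC

/-- Converse direction available by name for child 2 only: crux ⇒ TgLowEnergyCondensation. -/
theorem crux_implies_child2 (hX : LadderThesis) : TgLowEnergyCondensation :=
  TwistGap.tgLowEnergyCondensation_of_lowEnergyRigidity (lowEnergyRigidity_of_ladderThesis hX)

/-! ## §B Mechanical probes (P1–P5). -/

set_option h21.cruxProbe.batteryMs 90000

#h21_crux_probe Summit.HubbardSuperconductivity.HubbardSuperconductivity.Theses.DeformationLadder.LadderThesis route := "route-HubbardSuperconductivity-DeformationLadder"

#h21_crux_probe Summit.HubbardSuperconductivity.HubbardSuperconductivity.Theses.TwistGap.TgPairMomentumRigidity summit := _root_.HubbardSuperconductivity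

#h21_crux_probe Summit.HubbardSuperconductivity.HubbardSuperconductivity.Theses.TwistGap.TgLowEnergyCondensation summit := _root_.HubbardSuperconductivity

end Summit.HubbardSuperconductivity.HubbardSuperconductivity.Cruxes.LadderThesis.StrategistR1
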